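import Summits.QuantumFields.YangMills.Theorems.AllWindowsColdBoxBoxHighLineSpectralFloorTools

/-!
# T-S5.4v «rows of a perturbed inverse» — `‖row_x((A+E)⁻¹)‖₂ ≤ 2 ‖row_x(A⁻¹)‖₂`, hence diagonal entries and the Hilbert–Schmidt norm of
# `((A+E)ᵀ(A+E))⁻¹` are at most `4×` those at `E = 0`

Untabled brick of step (1b)/(1c) (planner ym-idea-2 g17, `STUB-PLAN-S5U5-STEP1c.md` §2 «precision» and SHELL-BUDGET-S5U5.md §1) for the XL
comparison stubs S5 (LINE-19 ⟨stmt-QuantumFields-24004⟩/⟨24335⟩) and U5 (LINE-20 ⟨24336⟩).  The Laplace step T-S5.4 runs at the PERTURBED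
Faddeev–Popov operator `F = fpOperator H V = F₁ + E(V)` (w2 g30's 4c/4c-E: `‖E v‖ ≤ m‖v‖`, w4 g27's ✓SpectralFloorTools: `l‖v‖ ≤ ‖F₁ v‖`), while the two
Gaussian budget numbers are known at the FLAT operator `F₁` only:

* the per-coordinate variances `Var_x = (2β)⁻¹ · ((FᵀF)⁻¹)_{xx} = (2β)⁻¹ · Σ_t (F⁻¹ x t)²` (relative Gaussian tails of the bulk cut-off), flat value
  `≤ C(1+log H)⁴/(2β)` by ✓T-S5.4i `dirichletGreenRowSqSum`;
* the trace `tr (FᵀF)⁻¹ = ‖F⁻¹‖_HS² = Σ_x Σ_t (F⁻¹ x t)²` (the `R = O(H⁴ polylog/β)` of STEP1b §3), flat value by ✓`dirichletGreenHilbertSchmidt`.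

An operator-norm floor alone (w4's `inv_opBound_of_opFloor`) would only give `((FᵀF)⁻¹)_{xx} ≤ ‖F⁻¹‖₂² ≍ H⁴` — too weak.  This file proves the
RELATIVE statement, in the letters of ✓SpectralFloorTools (squared-form hypotheses, no operator norms):

* **`inv_row_sq_le_four_mul`**: `l²‖v‖² ≤ ‖A v‖²`, `‖E v‖² ≤ m²‖v‖²`, `0 < l`, `0 ≤ m`, `2m ≤ l` ⇒ for every row index `x`,
  `Σ_t ((A+E)⁻¹ x t)² ≤ 4 · Σ_t (A⁻¹ x t)²`.
  Proof: `r := row_x((A+E)⁻¹)`, `y := row_x(A⁻¹)` satisfy `r = y − r ᵥ* X`, `X = E A⁻¹` (from `r ᵥ* (A+E) = e_x = y ᵥ* A`); `‖X v‖ ≤ (m/l)‖v‖ ≤ ½‖v‖`,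
  and the same bound for the ROW action `r ↦ r ᵥ* X` (`‖Xᵀ‖ = ‖X‖`, proved by Cauchy–Schwarz: `‖Xᵀr‖² = r·(X Xᵀ r) ≤ ‖r‖·½‖Xᵀ r‖`); so
  `‖r‖ ≤ ‖y‖ + ½‖r‖`.
* `inv_frobenius_sq_le_four_mul` — summed over `x`: `‖(A+E)⁻¹‖_HS² ≤ 4 ‖A⁻¹‖_HS²`;
* `inv_mul_transpose_diag_le_four_mul`, `trace_inv_transpose_mul_le_four_mul` — the same two facts in the `((A+E)ᵀ(A+E))⁻¹ = (A+E)⁻¹(A+E)⁻ᵀ`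
  letters of STEP1c (`(FᵀF)⁻¹ = F⁻¹F⁻ᵀ`).

Tree (✓SpectralFloorTools) + Mathlib; no definitions.  HONEST LABEL: an elementary matrix brick of step (1b)/(1c); T-S5.4 proper, S5, U5, ⟨24004⟩ ⟨24335⟩
⟨24336⟩ remain OPEN; no summit is proved; the Yang–Mills mass gap is NOT proved by this file.  Seat ym-line-sfw-p2 g77 (LEAD, cell ym-idea-1).
-/

set_option autoImplicit false

noncomputable section

open Finset Matrix

namespace Summit.QuantumFields.YangMills.Theorems.AllWindowsColdBoxBoxHighLine

namespace SpectralFloor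

section Rows

variable {ι : Type*} [Fintype ι]

/-- `Σ_t (v t)² = v ⬝ᵥ v`. -/
theorem sum_sq_eq_dotProduct_self (v : ι → ℝ) : ∑ t, (v t) ^ 2 = v ⬝ᵥ v := by
  simp only [dotProduct, pow_two]

/-- Triangle inequality for `√(·⬝·)`: `√((y − u)⬝(y − u)) ≤ √(y⬝y) + √(u⬝u)` (Cauchy–Schwarz `|y⬝u| ≤ √(y⬝y)√(u⬝u)`, cf. the tree's
`B2Sect3AReplacement587.abs_dotProduct_le_sqrt`, re-derived inline from `Finset.sum_mul_sq_le_sq_mul_sq` to keep this file Mathlib + SpectralFloorTools only). -/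
theorem sqrt_dotProduct_sub_le (y u : ι → ℝ) :
    Real.sqrt ((y - u) ⬝ᵥ (y - u)) ≤ Real.sqrt (y ⬝ᵥ y) + Real.sqrt (u ⬝ᵥ u) := by
  have hyy : 0 ≤ y ⬝ᵥ y := Finset.sum_nonneg fun i _ => mul_self_nonneg _
  have huu : 0 ≤ u ⬝ᵥ u := Finset.sum_nonneg fun i _ => mul_self_nonneg _
  have hcs : |y ⬝ᵥ u| ≤ Real.sqrt (y ⬝ᵥ y) * Real.sqrt (u ⬝ᵥ u) := by
    have h2 : (y ⬝ᵥ u) ^ 2 ≤ (y ⬝ᵥ y) * (u ⬝ᵥ u) := by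
      simpa only [dotProduct, sq] using Finset.sum_mul_sq_le_sq_mul_sq Finset.univ y u
    rw [← Real.sqrt_mul hyy, ← Real.sqrt_sq_eq_abs]
    exact Real.sqrt_le_sqrt h2
  have hexp : (y - u) ⬝ᵥ (y - u) = y ⬝ᵥ y - 2 * (y ⬝ᵥ u) + u ⬝ᵥ u := by
    simp only [sub_dotProduct, dotProduct_sub, dotProduct_comm u y]; ring
  have hle : (y - u) ⬝ᵥ (y - u) ≤ (Real.sqrt (y ⬝ᵥ y) + Real.sqrt (u ⬝ᵥ u)) ^ 2 := by
    rw [hexp, add_sq, Real.sq_sqrt hyy, Real.sq_sqrt huu]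
    have := neg_abs_le (y ⬝ᵥ u)
    nlinarith
  calc Real.sqrt ((y - u) ⬝ᵥ (y - u)) ≤ Real.sqrt ((Real.sqrt (y ⬝ᵥ y) + Real.sqrt (u ⬝ᵥ u)) ^ 2) := Real.sqrt_le_sqrt hle
    _ = Real.sqrt (y ⬝ᵥ y) + Real.sqrt (u ⬝ᵥ u) := Real.sqrt_sq (by positivity)

/-- **Transpose bound**: an operator bound `‖X v‖² ≤ ρ²‖v‖²` gives the same bound for the row action, `‖r ᵥ* X‖² ≤ ρ²‖r‖²`
(`‖Xᵀ‖ = ‖X‖`; Cauchy–Schwarz: `‖Xᵀr‖² = r·(X Xᵀr) ≤ ‖r‖ ρ ‖Xᵀr‖`). -/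
theorem vecMul_dotProduct_self_le (X : Matrix ι ι ℝ) {ρ : ℝ}
    (hX : ∀ v : ι → ℝ, (X *ᵥ v) ⬝ᵥ (X *ᵥ v) ≤ ρ ^ 2 * (v ⬝ᵥ v)) (r : ι → ℝ) :
    (r ᵥ* X) ⬝ᵥ (r ᵥ* X) ≤ ρ ^ 2 * (r ⬝ᵥ r) := by
  set u := r ᵥ* X with hu
  have huu0 : 0 ≤ u ⬝ᵥ u := Finset.sum_nonneg fun i _ => mul_self_nonneg _
  have hrr0 : 0 ≤ r ⬝ᵥ r := Finset.sum_nonneg fun i _ => mul_self_nonneg _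
  -- `u⬝u = r ⬝ (X u)`
  have hid : u ⬝ᵥ u = r ⬝ᵥ (X *ᵥ u) := by rw [Matrix.dotProduct_mulVec]
  have hcs : (r ⬝ᵥ (X *ᵥ u)) ^ 2 ≤ (r ⬝ᵥ r) * ((X *ᵥ u) ⬝ᵥ (X *ᵥ u)) := by
    simpa only [dotProduct, sq] using Finset.sum_mul_sq_le_sq_mul_sq Finset.univ r (X *ᵥ u)
  have h4 : (u ⬝ᵥ u) ^ 2 ≤ (r ⬝ᵥ r) * (ρ ^ 2 * (u ⬝ᵥ u)) :=
    (hid ▸ hcs).trans (mul_le_mul_of_nonneg_left (hX u) hrr0)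
  by_cases h0 : u ⬝ᵥ u = 0
  · rw [h0]; exact mul_nonneg (sq_nonneg _) hrr0
  · have hpos : 0 < u ⬝ᵥ u := lt_of_le_of_ne huu0 (Ne.symm h0)
    have : (u ⬝ᵥ u) * (u ⬝ᵥ u) ≤ (u ⬝ᵥ u) * (ρ ^ 2 * (r ⬝ᵥ r)) := by rw [← sq]; linarith
    exact le_of_mul_le_mul_left this hpos

variable [DecidableEq ι]

omit [DecidableEq ι] in
/-- Row `x` of a product: `(M x) ᵥ* N = (M * N) x`. -/
theorem row_vecMul_eq_mul_apply (M N : Matrix ι ι ℝ) (x : ι) : (fun t => M x t) ᵥ* N = fun j => (M * N) x j := by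
  funext j
  simp only [Matrix.vecMul, dotProduct, Matrix.mul_apply]

/-- **Rows of a perturbed inverse**: `l²‖v‖² ≤ ‖Av‖²`, `‖Ev‖² ≤ m²‖v‖²`, `0 < l`, `0 ≤ m`, `2m ≤ l` ⇒ for every row index `x`,
`Σ_t ((A+E)⁻¹ x t)² ≤ 4 Σ_t (A⁻¹ x t)²`. -/
theorem inv_row_sq_le_four_mul (A E : Matrix ι ι ℝ) {l m : ℝ} (hl : 0 < l) (hm : 0 ≤ m) (h2m : 2 * m ≤ l)
    (hA : ∀ v : ι → ℝ, l ^ 2 * (v ⬝ᵥ v) ≤ (A *ᵥ v) ⬝ᵥ (A *ᵥ v))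
    (hE : ∀ v : ι → ℝ, (E *ᵥ v) ⬝ᵥ (E *ᵥ v) ≤ m ^ 2 * (v ⬝ᵥ v)) (x : ι) :
    ∑ t, ((A + E)⁻¹ x t) ^ 2 ≤ 4 * ∑ t, (A⁻¹ x t) ^ 2 := by
  have hml : m ≤ l := by linarith
  -- invertibility of `A` and of `A + E`
  have hAu : IsUnit A.det := isUnit_det_of_opFloor A (by positivity : 0 < l ^ 2) hA
  have hfl := opFloor_add A E hm hml hA hE
  have hAEu : IsUnit (A + E).det := isUnit_det_of_opFloor (A + E) (by nlinarith : 0 < (l - m) ^ 2) hfl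
  -- the rows and the perturbation operator `X = E A⁻¹`
  set r : ι → ℝ := fun t => (A + E)⁻¹ x t with hr
  set y : ι → ℝ := fun t => A⁻¹ x t with hy
  set X : Matrix ι ι ℝ := E * A⁻¹ with hXdef
  -- `r ᵥ* (A + E) = e_x = y ᵥ* A`
  have hr1 : r ᵥ* (A + E) = fun j => (1 : Matrix ι ι ℝ) x j := by
    rw [hr, row_vecMul_eq_mul_apply, Matrix.nonsing_inv_mul _ hAEu]
  have hy1 : y ᵥ* A = fun j => (1 : Matrix ι ι ℝ) x j := by
    rw [hy, row_vecMul_eq_mul_apply, Matrix.nonsing_inv_mul _ hAu]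
  -- `r = y − r ᵥ* X`
  have hrel : r = y - r ᵥ* X := by
    have h1 : r ᵥ* A + r ᵥ* E = y ᵥ* A := by rw [← Matrix.vecMul_add, hr1, hy1]
    have h2 : (r ᵥ* A + r ᵥ* E) ᵥ* A⁻¹ = (y ᵥ* A) ᵥ* A⁻¹ := by rw [h1]
    rw [Matrix.add_vecMul, Matrix.vecMul_vecMul, Matrix.vecMul_vecMul, Matrix.vecMul_vecMul,
      Matrix.mul_nonsing_inv _ hAu, Matrix.vecMul_one, Matrix.vecMul_one] at h2
    rw [hXdef, eq_sub_iff_add_eq]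
    exact h2
  -- `‖X v‖ ≤ (m/l) ‖v‖ ≤ ½ ‖v‖`
  have hX : ∀ v : ι → ℝ, (X *ᵥ v) ⬝ᵥ (X *ᵥ v) ≤ (1 / 2) ^ 2 * (v ⬝ᵥ v) := by
    intro v
    have h1 : (X *ᵥ v) ⬝ᵥ (X *ᵥ v) ≤ m ^ 2 * ((A⁻¹ *ᵥ v) ⬝ᵥ (A⁻¹ *ᵥ v)) := by
      rw [hXdef, ← Matrix.mulVec_mulVec]; exact hE _
    have h2 : l ^ 2 * ((A⁻¹ *ᵥ v) ⬝ᵥ (A⁻¹ *ᵥ v)) ≤ v ⬝ᵥ v := inv_opBound_of_opFloor A hAu hA v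
    have hvv : 0 ≤ v ⬝ᵥ v := Finset.sum_nonneg fun i _ => mul_self_nonneg _
    have hAv : 0 ≤ (A⁻¹ *ᵥ v) ⬝ᵥ (A⁻¹ *ᵥ v) := Finset.sum_nonneg fun i _ => mul_self_nonneg _
    have h3 : m ^ 2 * ((A⁻¹ *ᵥ v) ⬝ᵥ (A⁻¹ *ᵥ v)) ≤ (1 / 2) ^ 2 * (l ^ 2 * ((A⁻¹ *ᵥ v) ⬝ᵥ (A⁻¹ *ᵥ v))) := by
      have : m ^ 2 ≤ (1 / 2) ^ 2 * l ^ 2 := by nlinarith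
      nlinarith
    calc (X *ᵥ v) ⬝ᵥ (X *ᵥ v) ≤ m ^ 2 * ((A⁻¹ *ᵥ v) ⬝ᵥ (A⁻¹ *ᵥ v)) := h1
      _ ≤ (1 / 2) ^ 2 * (l ^ 2 * ((A⁻¹ *ᵥ v) ⬝ᵥ (A⁻¹ *ᵥ v))) := h3
      _ ≤ (1 / 2) ^ 2 * (v ⬝ᵥ v) := mul_le_mul_of_nonneg_left h2 (by norm_num)
  -- norms
  set u : ι → ℝ := r ᵥ* X with hu
  have huu : u ⬝ᵥ u ≤ (1 / 2) ^ 2 * (r ⬝ᵥ r) := vecMul_dotProduct_self_le X hX r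
  have hrr0 : 0 ≤ r ⬝ᵥ r := Finset.sum_nonneg fun i _ => mul_self_nonneg _
  have hyy0 : 0 ≤ y ⬝ᵥ y := Finset.sum_nonneg fun i _ => mul_self_nonneg _
  have hnu : Real.sqrt (u ⬝ᵥ u) ≤ (1 / 2) * Real.sqrt (r ⬝ᵥ r) := by
    calc Real.sqrt (u ⬝ᵥ u) ≤ Real.sqrt ((1 / 2) ^ 2 * (r ⬝ᵥ r)) := Real.sqrt_le_sqrt huu
      _ = (1 / 2) * Real.sqrt (r ⬝ᵥ r) := by rw [Real.sqrt_mul' _ hrr0, Real.sqrt_sq (by norm_num)]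
  have htri : Real.sqrt (r ⬝ᵥ r) ≤ Real.sqrt (y ⬝ᵥ y) + Real.sqrt (u ⬝ᵥ u) := by
    have h := sqrt_dotProduct_sub_le y u
    rwa [← hrel] at h
  have hnr : Real.sqrt (r ⬝ᵥ r) ≤ 2 * Real.sqrt (y ⬝ᵥ y) := by linarith
  have hsq : r ⬝ᵥ r ≤ 4 * (y ⬝ᵥ y) := by
    have h1 : Real.sqrt (r ⬝ᵥ r) ^ 2 ≤ (2 * Real.sqrt (y ⬝ᵥ y)) ^ 2 :=
      pow_le_pow_left₀ (Real.sqrt_nonneg _) hnr 2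
    rw [Real.sq_sqrt hrr0, mul_pow, Real.sq_sqrt hyy0] at h1
    linarith
  simpa only [sum_sq_eq_dotProduct_self] using hsq

/-- **Hilbert–Schmidt form**: `‖(A+E)⁻¹‖_HS² ≤ 4 ‖A⁻¹‖_HS²` under the same hypotheses. -/
theorem inv_frobenius_sq_le_four_mul (A E : Matrix ι ι ℝ) {l m : ℝ} (hl : 0 < l) (hm : 0 ≤ m) (h2m : 2 * m ≤ l)
    (hA : ∀ v : ι → ℝ, l ^ 2 * (v ⬝ᵥ v) ≤ (A *ᵥ v) ⬝ᵥ (A *ᵥ v))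
    (hE : ∀ v : ι → ℝ, (E *ᵥ v) ⬝ᵥ (E *ᵥ v) ≤ m ^ 2 * (v ⬝ᵥ v)) :
    ∑ x, ∑ t, ((A + E)⁻¹ x t) ^ 2 ≤ 4 * ∑ x, ∑ t, (A⁻¹ x t) ^ 2 := by
  rw [Finset.mul_sum]
  exact Finset.sum_le_sum fun x _ => inv_row_sq_le_four_mul A E hl hm h2m hA hE x

/-- Diagonal entries of `M⁻¹ M⁻ᵀ = (MᵀM)⁻¹` are the squared row norms of `M⁻¹`. -/
theorem inv_mul_inv_transpose_diag (M : Matrix ι ι ℝ) (x : ι) : (M⁻¹ * (M⁻¹)ᵀ) x x = ∑ t, (M⁻¹ x t) ^ 2 := by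
  simp only [Matrix.mul_apply, Matrix.transpose_apply, pow_two]

/-- `(MᵀM)⁻¹ = M⁻¹ M⁻ᵀ`. -/
theorem transpose_mul_self_inv (M : Matrix ι ι ℝ) : (Mᵀ * M)⁻¹ = M⁻¹ * (M⁻¹)ᵀ := by
  rw [Matrix.mul_inv_rev, Matrix.transpose_nonsing_inv]

/-- **Diagonal form** (the per-coordinate Gaussian variances of STEP1c at the perturbed operator):
`(((A+E)ᵀ(A+E))⁻¹)_{xx} ≤ 4 · ((AᵀA)⁻¹)_{xx}`. -/
theorem inv_transpose_mul_diag_le_four_mul (A E : Matrix ι ι ℝ) {l m : ℝ} (hl : 0 < l) (hm : 0 ≤ m) (h2m : 2 * m ≤ l)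
    (hA : ∀ v : ι → ℝ, l ^ 2 * (v ⬝ᵥ v) ≤ (A *ᵥ v) ⬝ᵥ (A *ᵥ v))
    (hE : ∀ v : ι → ℝ, (E *ᵥ v) ⬝ᵥ (E *ᵥ v) ≤ m ^ 2 * (v ⬝ᵥ v)) (x : ι) :
    ((A + E)ᵀ * (A + E))⁻¹ x x ≤ 4 * (Aᵀ * A)⁻¹ x x := by
  rw [transpose_mul_self_inv, transpose_mul_self_inv, inv_mul_inv_transpose_diag, inv_mul_inv_transpose_diag]
  exact inv_row_sq_le_four_mul A E hl hm h2m hA hE x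

/-- **Trace form** (the `tr (FᵀF)⁻¹` of STEP1b §3 at the perturbed operator): `tr ((A+E)ᵀ(A+E))⁻¹ ≤ 4 · tr (AᵀA)⁻¹`. -/
theorem trace_inv_transpose_mul_le_four_mul (A E : Matrix ι ι ℝ) {l m : ℝ} (hl : 0 < l) (hm : 0 ≤ m) (h2m : 2 * m ≤ l)
    (hA : ∀ v : ι → ℝ, l ^ 2 * (v ⬝ᵥ v) ≤ (A *ᵥ v) ⬝ᵥ (A *ᵥ v))
    (hE : ∀ v : ι → ℝ, (E *ᵥ v) ⬝ᵥ (E *ᵥ v) ≤ m ^ 2 * (v ⬝ᵥ v)) :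
    ((A + E)ᵀ * (A + E))⁻¹.trace ≤ 4 * (Aᵀ * A)⁻¹.trace := by
  simp only [Matrix.trace, Matrix.diag, Finset.mul_sum]
  exact Finset.sum_le_sum fun x _ => inv_transpose_mul_diag_le_four_mul A E hl hm h2m hA hE x

end Rows

end SpectralFloor

end Summit.QuantumFields.YangMills.Theorems.AllWindowsColdBoxBoxHighLine

end
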